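import Mathlib
import Literature.Analysis.FluidPDE.Tao2016AveragedNS.WeightedLatticeFlows
import Summits.NavierStokesRegularity.NavierStokesRegularity.Theorems.HeteroclinicTriggerChainTriggerChainFrontStepSectorRows
import Summits.NavierStokesRegularity.NavierStokesRegularity.Theorems.HeteroclinicTriggerChainTriggerChainFrontStepSeededDatum
import HarnessLib

/-!
# `HeteroclinicTriggerChain` — crux `TriggerChainFrontStep` (item stmt-NavierStokesRegularity-22785):
  SECTOR INVARIANCE of exact weighted lattice flows

A dynamical (not merely algebraic) consequence of the proposed sector clause (J2) for the line
gapdata_v2. If a set of modes `M` is CLOSED for the table `α` — every family charging only modes of `M`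
exerts no force on the modes outside `M` (for the trigger chain: `M = {i₀, i₁}`, closedness = no
trigger self-interaction rows and no overlap-triad leak, tree file `…SectorRows`) — then every solution of
Tao's lattice in the weighted sup-norm Banach space `Fin m × ℤ →ᵇ ℝ` (the setting of
`exists_exact_pseudoFlowOn_of_apriori_bound`, module `WeightedLatticeFlows`) that starts inside the
sector STAYS inside the sector on its whole interval of existence:

* `htcSI_sector_invariant` — abstract form (any `m`, any `ε₀`, any closed mode set `M`): Grönwall on the
  junk part `χ·T` of the solution, using that the conjugated field is Lipschitz on balls and maps sector
  states to sector states (`‖χ·F(T)‖ = ‖χ·(F(T) − F((1−χ)·T))‖ ≤ L‖χ·T‖`);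
* `htcSI_closed_of_rows` — for a four-mode table obeying (parity) with vanishing pure rows and vanishing
  trigger-self-interaction / overlap rows into the junk modes, `{i₀,i₁}` is closed;
* `htcSI_closed_add_smul` — closedness passes to the pinned table `α₀ + βσ`.

So under (J2) the a priori bound of DYN-EXIST and the hop analysis of DYN-STEP may be carried out for the
TWO-SPECIES lattice (carrier/trigger amplitudes only), exactly as the numerics of the route do.

HONEST FRAMING: an elementary ODE fact (Grönwall/uniqueness) about Tao-type MODEL lattice flows
(Tao 2016 §4); helper for the crux, no stub credit; nothing here is a statement about the Navier–Stokes
equations; no summit, rung or crux is proved by this file.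
-/

noncomputable section

set_option linter.dupNamespace false

namespace Summit.NavierStokesRegularity.NavierStokesRegularity.Theorems

open Set Metric Filter Topology BoundedContinuousFunction
open Literature.Analysis.FluidPDE Literature.Analysis.FluidPDE.TaoCascade

/-- **SECTOR INVARIANCE (abstract).** Let the mode set `M` be closed for `α` (families charging only
modes of `M` exert no force outside `M`). Then a solution `T` of the conjugated lattice equation
`T' = F(T)` on `[0,s]` (weighted sup-norm space) whose initial state charges only modes of `M` charges
only modes of `M` at all times of `[0,s]`. [this file] -/
theorem htcSI_sector_invariant {m : ℕ} {ε₀ A Mα : ℝ}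
    {α : Fin m → Fin m → Fin m → ℤ × ℤ × ℤ → ℝ} {w : ℤ → ℝ}
    (hε : 0 ≤ 1 + ε₀) (hw : WeightRatiosLE ε₀ w A) (hMα : 0 ≤ Mα)
    (hα : ∀ i₁ i₂ i₃ μ, |α i₁ i₂ i₃ μ| ≤ Mα) (M : Finset (Fin m))
    (hclosed : ∀ X : Fin m → ℤ → ℝ → ℝ, (∀ i n t, i ∉ M → X i n t = 0) →
      ∀ (j : Fin m) (n : ℤ) (t : ℝ), j ∉ M → quadTerm ε₀ α X j n t = 0)
    {s : ℝ} (T : ℝ → (Fin m × ℤ →ᵇ ℝ))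
    (hT : ∀ t ∈ Icc 0 s, HasDerivWithinAt T (weightedField hε hw hMα hα (T t)) (Icc 0 s) t)
    (h0 : ∀ (j : Fin m) (k : ℤ), j ∉ M → T 0 (j, k) = 0) :
    ∀ t ∈ Icc 0 s, ∀ (j : Fin m) (k : ℤ), j ∉ M → T t (j, k) = 0 := by
  classical
  set F := weightedField hε hw hMα hα with hF
  -- the junk indicator as a bounded function, and the junk part of a state
  set χ : Fin m × ℤ →ᵇ ℝ := ofNormedAddCommGroupDiscrete (fun p => if p.1 ∈ M then (0 : ℝ) else 1) 1
    (fun p => by split_ifs <;> simp) with hχ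
  have hχapp : ∀ p : Fin m × ℤ, χ p = if p.1 ∈ M then (0 : ℝ) else 1 := fun p => rfl
  have hχnorm : ‖χ‖ ≤ 1 := (norm_le zero_le_one).2 fun p => by
    rw [hχapp]; split_ifs <;> simp
  have h1χnorm : ‖(1 : Fin m × ℤ →ᵇ ℝ) - χ‖ ≤ 1 := (norm_le zero_le_one).2 fun p => by
    rw [BoundedContinuousFunction.coe_sub, Pi.sub_apply, hχapp]
    split_ifs <;> simp
  -- sector states are mapped to sector states
  have hsec : ∀ U : Fin m × ℤ →ᵇ ℝ, χ * F ((1 - χ) * U) = 0 := by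
    intro U
    ext p
    obtain ⟨j, k⟩ := p
    rw [BoundedContinuousFunction.coe_mul, Pi.mul_apply, hχapp, BoundedContinuousFunction.coe_zero,
      Pi.zero_apply]
    by_cases hj : j ∈ M
    · simp [hj]
    · rw [if_neg hj, one_mul, hF, weightedField_apply]
      have hz := hclosed (fun j' n _ => ((1 - χ) * U) (j', n) / w n) (fun i n t hi => by
        simp only [BoundedContinuousFunction.coe_mul, BoundedContinuousFunction.coe_sub,
          BoundedContinuousFunction.coe_one, Pi.mul_apply, Pi.sub_apply, Pi.one_apply, hχapp,
          if_neg hi, sub_self, zero_mul, zero_div]) j k 0 hj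
      rw [hz, mul_zero]
  -- a bound for the trajectory
  have hcont : ContinuousOn T (Icc 0 s) := fun t ht => (hT t ht).continuousWithinAt
  obtain ⟨C, hC⟩ := isCompact_Icc.exists_bound_of_continuousOn hcont
  set R := max C 0 with hR
  have hR0 : 0 ≤ R := le_max_right _ _
  have hTR : ∀ t ∈ Icc 0 s, ‖T t‖ ≤ R := fun t ht => (hC t ht).trans (le_max_left _ _)
  have hlip := lipschitzOnWith_weightedField hε hw hMα hα hR0 (α := α)
  set L : ℝ := ((8 * (m : ℝ) ^ 2 * Mα * A * R).toNNReal : ℝ) with hL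
  -- the Grönwall estimate for the junk part
  have hbound : ∀ t ∈ Icc 0 s, ‖χ * F (T t)‖ ≤ L * ‖χ * T t‖ := by
    intro t ht
    have hU : T t ∈ closedBall (0 : Fin m × ℤ →ᵇ ℝ) R := by
      rw [mem_closedBall, dist_zero_right]; exact hTR t ht
    have hV : (1 - χ) * T t ∈ closedBall (0 : Fin m × ℤ →ᵇ ℝ) R := by
      rw [mem_closedBall, dist_zero_right]
      calc ‖(1 - χ) * T t‖ ≤ ‖(1 : Fin m × ℤ →ᵇ ℝ) - χ‖ * ‖T t‖ := norm_mul_le _ _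
        _ ≤ 1 * R := mul_le_mul h1χnorm (hTR t ht) (norm_nonneg _) zero_le_one
        _ = R := one_mul R
    have hdiff : χ * F (T t) = χ * (F (T t) - F ((1 - χ) * T t)) := by
      rw [mul_sub, hsec, sub_zero]
    have hsplit : T t - (1 - χ) * T t = χ * T t := by
      rw [sub_mul, one_mul]; abel
    calc ‖χ * F (T t)‖ = ‖χ * (F (T t) - F ((1 - χ) * T t))‖ := by rw [hdiff]
      _ ≤ ‖χ‖ * ‖F (T t) - F ((1 - χ) * T t)‖ := norm_mul_le _ _
      _ ≤ 1 * (L * ‖T t - (1 - χ) * T t‖) := by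
          refine mul_le_mul hχnorm ?_ (norm_nonneg _) zero_le_one
          rw [← dist_eq_norm, ← dist_eq_norm]
          exact hlip.dist_le_mul _ hU _ hV
      _ = L * ‖χ * T t‖ := by rw [one_mul, hsplit]
  have hf' : ∀ t ∈ Ico 0 s, HasDerivWithinAt (fun r => χ * T r) (χ * F (T t)) (Ici t) t := by
    intro t ht
    have h := (hT t (Ico_subset_Icc_self ht)).const_mul χ
    exact h.mono_of_mem_nhdsWithin (mem_of_superset (Icc_mem_nhdsGE ht.2)
      (Icc_subset_Icc ht.1 le_rfl))
  have hfc : ContinuousOn (fun r => χ * T r) (Icc 0 s) :=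
    fun t ht => ((hT t ht).const_mul χ).continuousWithinAt
  have hf0 : χ * T 0 = 0 := by
    ext p
    obtain ⟨j, k⟩ := p
    rw [BoundedContinuousFunction.coe_mul, Pi.mul_apply, hχapp, BoundedContinuousFunction.coe_zero,
      Pi.zero_apply]
    by_cases hj : j ∈ M
    · simp [hj]
    · rw [if_neg hj, h0 j k hj, mul_zero]
  have hzero := eq_zero_of_abs_deriv_le_mul_abs_self_of_eq_zero_right (K := L) hfc hf' hf0
    (fun t ht => hbound t (Ico_subset_Icc_self ht))
  intro t ht j k hj
  have h := congrArg (fun U : Fin m × ℤ →ᵇ ℝ => U (j, k)) (hzero t ht)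
  simp only [BoundedContinuousFunction.coe_mul, Pi.mul_apply, hχapp, if_neg hj, one_mul,
    BoundedContinuousFunction.coe_zero, Pi.zero_apply] at h
  exact h

/-- **The sector `{i₀,i₁}` is closed** for a four-mode table obeying the (parity) clause for `i₁ ≠ i₀`,
whose pure rows vanish (`τ i₀ i₀ j μ = 0` on `S`, e.g. by (purity)) and whose trigger self-interaction and
overlap rows into the junk modes vanish (`τ i₁ i₁ j μ = 0` on `S`, `j ∉ {i₀,i₁}`): families charging only
`i₀, i₁` exert no force on the junk modes. [this file] -/
theorem htcSI_closed_of_rows (τ : Fin 4 → Fin 4 → Fin 4 → ℤ × ℤ × ℤ → ℝ) (i₀ i₁ : Fin 4)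
    (hne : i₀ ≠ i₁)
    (hpar : ∀ (j₁ j₂ j₃ : Fin 4) (μ : ℤ × ℤ × ℤ), Xor (Xor (j₁ = i₁) (j₂ = i₁)) (j₃ = i₁) →
      τ j₁ j₂ j₃ μ = 0)
    (hpr : ∀ (j : Fin 4) (μ : ℤ × ℤ × ℤ), j ≠ i₀ → j ≠ i₁ → μ ∈ shiftSet → τ i₀ i₀ j μ = 0)
    (hrows : ∀ (j : Fin 4) (μ : ℤ × ℤ × ℤ), j ≠ i₀ → j ≠ i₁ → μ ∈ shiftSet → τ i₁ i₁ j μ = 0) :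
    ∀ X : Fin 4 → ℤ → ℝ → ℝ, (∀ i n t, i ∉ ({i₀, i₁} : Finset (Fin 4)) → X i n t = 0) →
      ∀ (j : Fin 4) (n : ℤ) (t : ℝ), j ∉ ({i₀, i₁} : Finset (Fin 4)) → quadTerm 1 τ X j n t = 0 := by
  intro X hX j n t hj
  have hmem : ∀ i : Fin 4, i ∉ ({i₀, i₁} : Finset (Fin 4)) ↔ (i ≠ i₀ ∧ i ≠ i₁) := fun i => by
    simp [not_or]
  obtain ⟨hj0, hj1⟩ := (hmem j).1 hj
  have hXs : ∀ j' n', j' ≠ i₀ → j' ≠ i₁ → X j' n' t = 0 :=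
    fun j' n' h0 h1 => hX j' n' t ((hmem j').2 ⟨h0, h1⟩)
  rw [htcSR_quadTerm_junk_of_parity τ i₀ i₁ hne hpar X t hXs j hj1
    (fun μ hμ => hpr j μ hj0 hj1 hμ) n,
    hrows j (0, 0, 0) hj0 hj1 (by decide), hrows j (1, 0, 0) hj0 hj1 (by decide),
    hrows j (0, 1, 0) hj0 hj1 (by decide), hrows j (0, 0, 1) hj0 hj1 (by decide)]
  ring

/-- **Closedness passes to the pinned table**: if `M` is closed for `α₀` and for `σ` then it is closed
for `α₀ + β·σ`. [this file] -/
theorem htcSI_closed_add_smul {m : ℕ} (ε₀ β : ℝ) (α₀ σ : Fin m → Fin m → Fin m → ℤ × ℤ × ℤ → ℝ)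
    (M : Finset (Fin m))
    (h₀ : ∀ X : Fin m → ℤ → ℝ → ℝ, (∀ i n t, i ∉ M → X i n t = 0) →
      ∀ (j : Fin m) (n : ℤ) (t : ℝ), j ∉ M → quadTerm ε₀ α₀ X j n t = 0)
    (h₁ : ∀ X : Fin m → ℤ → ℝ → ℝ, (∀ i n t, i ∉ M → X i n t = 0) →
      ∀ (j : Fin m) (n : ℤ) (t : ℝ), j ∉ M → quadTerm ε₀ σ X j n t = 0) :
    ∀ X : Fin m → ℤ → ℝ → ℝ, (∀ i n t, i ∉ M → X i n t = 0) →
      ∀ (j : Fin m) (n : ℤ) (t : ℝ), j ∉ M →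
        quadTerm ε₀ (fun j₁ j₂ j₃ μ => α₀ j₁ j₂ j₃ μ + β * σ j₁ j₂ j₃ μ) X j n t = 0 := by
  intro X hX j n t hj
  rw [htcSD_quadTerm_add_smul, h₀ X hX j n t hj, h₁ X hX j n t hj, mul_zero, add_zero]

end Summit.NavierStokesRegularity.NavierStokesRegularity.Theorems

end
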